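import Mathlib
import Literature.NumberTheory.Transcendental.KZSemialgebraicComplex
import Summits.KontsevichZagierPeriods.KontsevichZagierPeriods.Theorems.SoloInformedCubeResolution
import HarnessLib
import HarnessLib.Audit

/-!
# SoloInformed — real-algebraic coefficients: semialgebraicity, representations, cube germs

The DEN-calculus of the cube crux (`SoloInformedToric*`: rules ND, VERTEX, DIAG, SPLIT, LEMMA DOM)
was developed for denominators `Q ∈ ℚ[x]`.  Its resolution moves — affine splits of an edge at a
boundary zero of `Q`, translations of that zero to a vertex — leave `ℚ[x]` as soon as the zero has
irrational (real algebraic) coordinates; the first instance is `Q = (2x₀² − 1)² + x₁` on `[0,1]²`,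
whose only zero `(1/√2, 0)` lies in the interior of the bottom edge.  Kontsevich–Zagier allow
*algebraic* coefficients (§1.1: "rational" may be replaced by "algebraic"), and inside the KZ
calculus this costs nothing: the graph of `x ↦ P(x)` for `P` with real algebraic coefficients is a
`ℚ`-semialgebraic set.

This file re-bases the three entry points of the calculus on an arbitrary coefficient field `K`
with an embedding `algebraMap K ℝ` whose image consists of algebraic numbers
(`hK : ∀ c, IsAlgebraic ℚ (algebraMap K ℝ c)`; e.g. `K = ℚ`, `K = ℚ(√2)`, `K =` the field of real
algebraic numbers `algebraicClosure ℚ ℝ`):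

* LEMMA ALG-COEFF (`soloInformed_isSemialgebraicFunOn_aevalK`, `…_div`): `x ↦ P(x)` and
  `x ↦ P(x)/Q(x)` (`P, Q ∈ K[x]`, `Q ≠ 0` on `s`) are `ℚ`-semialgebraic functions on every
  `ℚ`-semialgebraic `s ⊆ ℝⁿ`; hence `∫_s P/Q` is an `IntegralRep` (`soloInformedOfRationalK`,
  generalising `IntegralRep.ofRational`);
* `K`-rational cube germs (`soloInformedRationalGermK`, generalising `soloInformedRationalGerm`):
  for `q ≠ 0` on `[0,1]ⁿ` the function `p/q` is a cube germ — analytic near the complexified cube,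
  real on real points, and *algebraic over `ℚ(z)`*: the relation `q T − p ∈ K[z, T]` divides the
  image of a non-zero polynomial with rational coefficients, because `K[z, T]` is an algebraic
  `ℚ[z, T]`-algebra (`MvPolynomial.exists_dvd_map_of_isAlgebraic`);
* the real part of the germ on real points is `p(x)/q(x)` (`soloInformedRationalGermK_g_re`), the
  identity fed to `soloInformed_presentable_of_nashImage` by the toric charts.

References: Kontsevich–Zagier 2001, §1.1; Bochnak–Coste–Roy 1998, Prop. 2.2.6; J. Ayoub, EMS
Newsl. 91 (2014), Def. 9; Huber–Müller-Stach 2017, Def. 12.1.1.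
-/

noncomputable section

open scoped BigOperators
open MeasureTheory Set
open Literature.NumberTheory.Transcendental Literature.NumberTheory.Transcendental.KZ
open Literature.ModelTheory.ExponentialFields (IsSemialgebraic)

namespace Summit.KontsevichZagierPeriods.KontsevichZagierPeriods.Theorems

variable {K : Type*} [Field K] [Algebra K ℝ] {n : ℕ}

/-! ### Coefficient fields with algebraic image -/

/-- A field embedded in `ℝ` has characteristic zero. -/
theorem soloInformed_charZero_of_embedding (K : Type*) [Field K] [Algebra K ℝ] : CharZero K :=
  (algebraMap K ℝ).charZero

/-- A field embedded in `ℝ` with algebraic image is an algebraic extension of `ℚ` (for the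
canonical `ℚ`-algebra structure of a characteristic-zero field). -/
theorem soloInformed_isAlgebraic_of_embedding [CharZero K]
    (hK : ∀ c : K, IsAlgebraic ℚ (algebraMap K ℝ c)) : Algebra.IsAlgebraic ℚ K :=
  ⟨fun c => (isAlgebraic_algHom_iff (algebraMap K ℝ).toRatAlgHom (algebraMap K ℝ).injective).1
    (hK c)⟩

/-- The coefficient field `ℚ` qualifies. -/
theorem soloInformed_algCoeff_rat : ∀ c : ℚ, IsAlgebraic ℚ (algebraMap ℚ ℝ c) :=
  fun c => isAlgebraic_algebraMap c

/-- The field of real algebraic numbers qualifies. -/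
theorem soloInformed_algCoeff_algebraicClosure :
    ∀ c : algebraicClosure ℚ ℝ, IsAlgebraic ℚ (algebraMap (algebraicClosure ℚ ℝ) ℝ c) :=
  fun c => mem_algebraicClosure_iff.1 c.2

/-- Every intermediate field of `ℝ/ℚ` consisting of algebraic numbers qualifies. -/
theorem soloInformed_algCoeff_intermediateField (F : IntermediateField ℚ ℝ)
    (hF : F ≤ algebraicClosure ℚ ℝ) : ∀ c : F, IsAlgebraic ℚ (algebraMap F ℝ c) :=
  fun c => mem_algebraicClosure_iff.1 (hF c.2)

/-! ### Complexification of `K`-polynomials -/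

/-- The embedding `K → ℝ → ℂ`. -/
def soloInformedKToC (K : Type*) [Field K] [Algebra K ℝ] : K →+* ℂ :=
  Complex.ofRealHom.comp (algebraMap K ℝ)

/-- Values of `soloInformedKToC`. -/
@[simp] theorem soloInformedKToC_apply (c : K) :
    soloInformedKToC K c = ((algebraMap K ℝ c : ℝ) : ℂ) := rfl

/-- Real points: `(P(x) : ℂ) = P^ℂ(ι x)` for `P ∈ K[x₁, …, xₙ]`. -/
theorem soloInformed_ofReal_aevalK (x : Fin n → ℝ) (P : MvPolynomial (Fin n) K) :
    ((MvPolynomial.aeval x P : ℝ) : ℂ) =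
      MvPolynomial.eval₂ (soloInformedKToC K) (soloInformedToC n x) P := by
  have h := MvPolynomial.eval₂_comp_left Complex.ofRealHom (algebraMap K ℝ) x P
  rw [MvPolynomial.aeval_def]
  exact h

/-- The complexified polynomial function `z ↦ P^ℂ(z)` is the evaluation of `P` mapped to `ℂ[z]`. -/
theorem soloInformed_eval₂K_eq_eval_map (P : MvPolynomial (Fin n) K) (z : Fin n → ℂ) :
    MvPolynomial.eval₂ (soloInformedKToC K) z P =
      MvPolynomial.eval z (MvPolynomial.map (soloInformedKToC K) P) := by
  rw [MvPolynomial.eval_map]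

/-- `K`-polynomial functions are analytic on `ℂⁿ`. -/
theorem soloInformed_analyticOnNhd_eval₂K (P : MvPolynomial (Fin n) K) :
    AnalyticOnNhd ℂ (fun z : Fin n → ℂ => MvPolynomial.eval₂ (soloInformedKToC K) z P) Set.univ := by
  have h : (fun z : Fin n → ℂ => MvPolynomial.eval₂ (soloInformedKToC K) z P) =
      fun z => MvPolynomial.eval z (MvPolynomial.map (soloInformedKToC K) P) :=
    funext fun z => soloInformed_eval₂K_eq_eval_map P z
  rw [h]
  exact AnalyticOnNhd.eval_mvPolynomial _

/-- `K`-polynomial functions are continuous on `ℝⁿ`. -/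
theorem soloInformed_continuous_aevalK (P : MvPolynomial (Fin n) K) :
    Continuous fun x : Fin n → ℝ => (MvPolynomial.aeval x P : ℝ) := by
  have h : (fun x : Fin n → ℝ => (MvPolynomial.aeval x P : ℝ)) =
      fun x => MvPolynomial.eval x (MvPolynomial.map (algebraMap K ℝ) P) :=
    funext fun x => by rw [MvPolynomial.eval_map, MvPolynomial.aeval_def]
  rw [h]
  exact MvPolynomial.continuous_eval _

/-! ### LEMMA ALG-COEFF: semialgebraicity of `K`-polynomial and `K`-rational functions -/

/-- **LEMMA ALG-COEFF.** A polynomial with real algebraic coefficients is a `ℚ`-semialgebraic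
function on every `ℚ`-semialgebraic set: constants `c ∈ ℚ̄ ∩ ℝ` are `ℚ`-semialgebraic functions
(their graph is cut out by the minimal polynomial and rational isolating inequalities), and
semialgebraic functions form a ring. [cite: BochnakCosteRoy1998, Prop. 2.2.6] -/
theorem soloInformed_isSemialgebraicFunOn_aevalK (hK : ∀ c : K, IsAlgebraic ℚ (algebraMap K ℝ c))
    {s : Set (Fin n → ℝ)} (hs : IsSemialgebraic ℚ s) (P : MvPolynomial (Fin n) K) :
    IsSemialgebraicFunOn ℚ s (fun x => (MvPolynomial.aeval x P : ℝ)) := by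
  induction P using MvPolynomial.induction_on with
  | C a =>
    exact (isSemialgebraicFunOn_const_of_isAlgebraic hs (hK a)).congr fun x _ => by simp
  | add p q hp hq =>
    exact (hp.add_holds hq).congr fun x _ => by simp
  | mul_X p i hp =>
    have hX : IsSemialgebraicFunOn ℚ s (fun x : Fin n → ℝ => x i) :=
      (isSemialgebraicFunOn_aeval hs (MvPolynomial.X i : MvPolynomial (Fin n) ℚ)).congr
        fun x _ => by simp
    exact (hp.mul_holds hX).congr fun x _ => by simp

/-- **LEMMA ALG-COEFF, rational functions.** `x ↦ P(x)/Q(x)` with `P, Q ∈ K[x]` and `Q ≠ 0` on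
`s` is a `ℚ`-semialgebraic function on the `ℚ`-semialgebraic set `s`.
[cite: BochnakCosteRoy1998, Prop. 2.2.6] -/
theorem soloInformed_isSemialgebraicFunOn_aevalK_div
    (hK : ∀ c : K, IsAlgebraic ℚ (algebraMap K ℝ c)) {s : Set (Fin n → ℝ)}
    (hs : IsSemialgebraic ℚ s) (P Q : MvPolynomial (Fin n) K)
    (hQ : ∀ x ∈ s, (MvPolynomial.aeval x Q : ℝ) ≠ 0) :
    IsSemialgebraicFunOn ℚ s
      (fun x => (MvPolynomial.aeval x P : ℝ) / MvPolynomial.aeval x Q) :=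
  (soloInformed_isSemialgebraicFunOn_aevalK hK hs P).div
    (soloInformed_isSemialgebraicFunOn_aevalK hK hs Q) hQ

/-! ### Integral representations with `K`-rational integrands -/

/-- The integral representation `∫_σ p/q` for `p, q ∈ K[x₁, …, xₙ]` (`K` a field of real
algebraic numbers), `q ≠ 0` on the `ℚ`-semialgebraic set `σ`, absolutely convergent.  For `K = ℚ`
this is `IntegralRep.ofRational`. [cite: KontsevichZagier2001, §1.1] -/
def soloInformedOfRationalK (hK : ∀ c : K, IsAlgebraic ℚ (algebraMap K ℝ c))
    (σ : Set (Fin n → ℝ)) (p q : MvPolynomial (Fin n) K) (hσ : IsSemialgebraic ℚ σ)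
    (hq : ∀ x ∈ σ, (MvPolynomial.aeval x q : ℝ) ≠ 0)
    (hint : IntegrableOn (fun x => (MvPolynomial.aeval x p : ℝ) / MvPolynomial.aeval x q) σ) :
    IntegralRep n where
  domain := σ
  integrand x := MvPolynomial.aeval x p / MvPolynomial.aeval x q
  isSemialgebraic_domain := hσ
  isSemialgebraicFunOn_integrand := soloInformed_isSemialgebraicFunOn_aevalK_div hK hσ p q hq
  integrableOn := hint

/-- The domain of `soloInformedOfRationalK`. -/
@[simp] theorem soloInformedOfRationalK_domain (hK : ∀ c : K, IsAlgebraic ℚ (algebraMap K ℝ c))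
    (σ : Set (Fin n → ℝ)) (p q : MvPolynomial (Fin n) K) (hσ : IsSemialgebraic ℚ σ)
    (hq : ∀ x ∈ σ, (MvPolynomial.aeval x q : ℝ) ≠ 0)
    (hint : IntegrableOn (fun x => (MvPolynomial.aeval x p : ℝ) / MvPolynomial.aeval x q) σ) :
    (soloInformedOfRationalK hK σ p q hσ hq hint).domain = σ := rfl

/-- The integrand of `soloInformedOfRationalK` is `p/q`. -/
@[simp] theorem soloInformedOfRationalK_integrand
    (hK : ∀ c : K, IsAlgebraic ℚ (algebraMap K ℝ c))
    (σ : Set (Fin n → ℝ)) (p q : MvPolynomial (Fin n) K) (hσ : IsSemialgebraic ℚ σ)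
    (hq : ∀ x ∈ σ, (MvPolynomial.aeval x q : ℝ) ≠ 0)
    (hint : IntegrableOn (fun x => (MvPolynomial.aeval x p : ℝ) / MvPolynomial.aeval x q) σ) :
    (soloInformedOfRationalK hK σ p q hσ hq hint).integrand =
      fun x => (MvPolynomial.aeval x p : ℝ) / MvPolynomial.aeval x q := rfl

/-! ### `K`-rational cube germs -/

/-- Evaluation of the relation `q(z) T − p(z) ∈ K[z, T]` at `(z, t) ∈ ℂⁿ × ℂ`. -/
theorem soloInformed_eval₂_linearPolyK (p q : MvPolynomial (Fin n) K) (z : Fin n → ℂ) (t : ℂ) :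
    MvPolynomial.eval₂ (soloInformedKToC K) (Fin.snoc z t : Fin (n + 1) → ℂ)
      (MvPolynomial.X (Fin.last n) * MvPolynomial.rename Fin.castSucc q -
        MvPolynomial.rename Fin.castSucc p) =
    t * MvPolynomial.eval₂ (soloInformedKToC K) z q -
      MvPolynomial.eval₂ (soloInformedKToC K) z p := by
  simp only [MvPolynomial.eval₂_sub, MvPolynomial.eval₂_mul, MvPolynomial.eval₂_X, Fin.snoc_last,
    MvPolynomial.eval₂_rename, Function.comp_def, Fin.snoc_castSucc]

/-- The relation `q(z) T − p(z) ∈ K[z, T]` is not the zero polynomial as soon as `q` takes a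
non-zero value. -/
theorem soloInformed_linearPolyK_ne_zero (p q : MvPolynomial (Fin n) K) {z : Fin n → ℂ}
    (hz : MvPolynomial.eval₂ (soloInformedKToC K) z q ≠ 0) :
    MvPolynomial.X (Fin.last n) * MvPolynomial.rename Fin.castSucc q -
      MvPolynomial.rename Fin.castSucc p ≠ 0 := by
  intro h
  have h1 := soloInformed_eval₂_linearPolyK p q z 1
  have h0 := soloInformed_eval₂_linearPolyK p q z 0
  rw [h, MvPolynomial.eval₂_zero] at h1 h0
  exact hz (by linear_combination h0 - h1)

/-- **`K`-rational cube germ.** For `p, q ∈ K[z₁, …, zₙ]` (`K` a field of real algebraic numbers)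
with `q` non-vanishing on the real unit cube, `p/q` is a cube germ on `U = {q^ℂ ≠ 0}`: analytic,
real on real points, and algebraic over `ℚ(z)` — the relation `q T − p` divides (the image of) a
non-zero polynomial with rational coefficients since `K[z, T]` is algebraic over `ℚ[z, T]`.
For `K = ℚ` this is `soloInformedRationalGerm`. [cite: Ayoub2014, Def. 9] -/
def soloInformedRationalGermK (hK : ∀ c : K, IsAlgebraic ℚ (algebraMap K ℝ c))
    (p q : MvPolynomial (Fin n) K)
    (hq : ∀ x ∈ soloInformedCube n, (MvPolynomial.aeval x q : ℝ) ≠ 0) :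
    SoloInformedCubeGerm n where
  U := {z | MvPolynomial.eval₂ (soloInformedKToC K) z q ≠ 0}
  g z := MvPolynomial.eval₂ (soloInformedKToC K) z p / MvPolynomial.eval₂ (soloInformedKToC K) z q
  isOpen := isOpen_ne_fun (soloInformed_analyticOnNhd_eval₂K q).continuous continuous_const
  mapsTo x hx := by
    show MvPolynomial.eval₂ (soloInformedKToC K) (soloInformedToC n x) q ≠ 0
    rw [← soloInformed_ofReal_aevalK, Complex.ofReal_ne_zero]
    exact hq x hx
  analytic z hz :=
    ((soloInformed_analyticOnNhd_eval₂K p) z trivial).div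
      ((soloInformed_analyticOnNhd_eval₂K q) z trivial) hz
  real x _ := by
    show (MvPolynomial.eval₂ (soloInformedKToC K) (soloInformedToC n x) p /
      MvPolynomial.eval₂ (soloInformedKToC K) (soloInformedToC n x) q).im = 0
    rw [← soloInformed_ofReal_aevalK, ← soloInformed_ofReal_aevalK, ← Complex.ofReal_div,
      Complex.ofReal_im]
  algebraic := by
    haveI : CharZero K := soloInformed_charZero_of_embedding K
    haveI := soloInformed_isAlgebraic_of_embedding hK
    have h0 : (0 : Fin n → ℝ) ∈ soloInformedCube n := by
      simp [soloInformed_mem_cube_iff]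
    have hz0 : MvPolynomial.eval₂ (soloInformedKToC K) (soloInformedToC n 0) q ≠ 0 := by
      rw [← soloInformed_ofReal_aevalK, Complex.ofReal_ne_zero]
      exact hq 0 h0
    obtain ⟨g, hg0, u, hu⟩ :=
      MvPolynomial.exists_dvd_map_of_isAlgebraic (R := ℚ) (soloInformed_linearPolyK_ne_zero p q hz0)
    refine ⟨g, hg0, fun z hz => ?_⟩
    have hφ : (soloInformedKToC K).comp (algebraMap ℚ K) = algebraMap ℚ ℂ := Subsingleton.elim _ _
    have hz' : MvPolynomial.eval₂ (soloInformedKToC K) z q ≠ 0 := hz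
    rw [MvPolynomial.aeval_def, ← hφ, ← MvPolynomial.eval₂_map, hu, MvPolynomial.eval₂_mul,
      soloInformed_eval₂_linearPolyK, div_mul_cancel₀ _ hz', sub_self, zero_mul]

/-- The domain of the `K`-rational cube germ. -/
theorem soloInformedRationalGermK_U (hK : ∀ c : K, IsAlgebraic ℚ (algebraMap K ℝ c))
    (p q : MvPolynomial (Fin n) K)
    (hq : ∀ x ∈ soloInformedCube n, (MvPolynomial.aeval x q : ℝ) ≠ 0) :
    (soloInformedRationalGermK hK p q hq).U =
      {z | MvPolynomial.eval₂ (soloInformedKToC K) z q ≠ 0} := rfl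

/-- The function of the `K`-rational cube germ. -/
theorem soloInformedRationalGermK_g (hK : ∀ c : K, IsAlgebraic ℚ (algebraMap K ℝ c))
    (p q : MvPolynomial (Fin n) K)
    (hq : ∀ x ∈ soloInformedCube n, (MvPolynomial.aeval x q : ℝ) ≠ 0) (z : Fin n → ℂ) :
    (soloInformedRationalGermK hK p q hq).g z =
      MvPolynomial.eval₂ (soloInformedKToC K) z p /
        MvPolynomial.eval₂ (soloInformedKToC K) z q := rfl

/-- On real points the `K`-rational cube germ is `p(x)/q(x)`; in particular its real part is the
rational function itself (the identity used by the toric charts). -/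
theorem soloInformedRationalGermK_g_re (hK : ∀ c : K, IsAlgebraic ℚ (algebraMap K ℝ c))
    (p q : MvPolynomial (Fin n) K)
    (hq : ∀ x ∈ soloInformedCube n, (MvPolynomial.aeval x q : ℝ) ≠ 0) (x : Fin n → ℝ) :
    ((soloInformedRationalGermK hK p q hq).g (soloInformedToC n x)).re =
      (MvPolynomial.aeval x p : ℝ) / MvPolynomial.aeval x q := by
  rw [soloInformedRationalGermK_g, ← soloInformed_ofReal_aevalK, ← soloInformed_ofReal_aevalK,
    ← Complex.ofReal_div, Complex.ofReal_re]

/-- **Polynomial cube germ over `K`**: `p ∈ K[z₁, …, zₙ]` (the rational germ `p/1`). -/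
def soloInformedPolynomialGermK (hK : ∀ c : K, IsAlgebraic ℚ (algebraMap K ℝ c))
    (p : MvPolynomial (Fin n) K) : SoloInformedCubeGerm n :=
  soloInformedRationalGermK hK p 1 fun _ _ => by simp

/-! ### Cube integrals of `K`-rational functions are presented by a cube germ -/

/-- A representation on the closed cube whose integrand agrees on the cube with `p/q`,
`p, q ∈ K[x]`, `q ≠ 0` on the cube, is a cube integral of (the real part of) the `K`-rational cube
germ; hence it is presentable in the sense of THEOREM P_A (resolution form), by
`soloInformed_cubePresentation_of_germ`. -/
theorem soloInformed_cubePresentation_of_rationalK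
    (hK : ∀ c : K, IsAlgebraic ℚ (algebraMap K ℝ c)) (p q : MvPolynomial (Fin n) K)
    (hq : ∀ x ∈ soloInformedCube n, (MvPolynomial.aeval x q : ℝ) ≠ 0)
    (r : IntegralRep n) (hr : r.domain = soloInformedCube n)
    (hri : EqOn r.integrand (fun x => (MvPolynomial.aeval x p : ℝ) / MvPolynomial.aeval x q)
      (soloInformedCube n)) :
    ∃ (m : ℕ) (a : Fin m → SoloInformedAyoubGen n) (ρ : Fin m → IntegralRep n),
      (∀ i, (ρ i).domain = soloInformedCube n) ∧
      (∀ i, EqOn (ρ i).integrand (fun x => ((a i).f (soloInformedToC n x)).re)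
        (soloInformedCube n)) ∧
      of r - ∑ i, of (ρ i) ∈ relations :=
  soloInformed_cubePresentation_of_germ (soloInformedRationalGermK hK p q hq) r hr
    fun x hx => by dsimp only; rw [hri hx, soloInformedRationalGermK_g_re]

end Summit.KontsevichZagierPeriods.KontsevichZagierPeriods.Theorems
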